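import Mathlib.FieldTheory.IsAlgClosed.AlgebraicClosure
import Mathlib.RingTheory.RootsOfUnity.AlgebraicallyClosed
import Literature.Computability.MetaComplexity.SmolenskyCharacter
import Literature.Computability.MetaComplexity.SmolenskyHilbertHalf
import HarnessLib

/-!
# The immunity of `MOD_q` is at least `n/2` (Beck–Li 2013, Theorem 3.4): no non-zero polynomial
# of degree `< n/2` over `𝔽_p` is supported inside one residue class of the Hamming weight mod `q`

Beck–Li, *Represent MOD function by low degree polynomial with unbounded one-sided error*
(arXiv:1304.0713, 2013), §3, in the "Razborov–Smolensky ring" `R = 𝔽_p[x₁,…,xₙ]/(xᵢ² = xᵢ)`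
(= the tree's `Smolensky.CubeFn (ZMod p) n` with the degree filtration `Smolensky.lowDeg`):

* Def. 3.1: `χ_q(x) = 1` if `q` divides `|x|`, `0` otherwise; "the immunity/weak `p`-degree of
  `χ_q` is the smallest degree of a nontrivial element of the ideal generated by `χ_q` in `R`"
  (Obs. 3.2: `f ∈ ⟨χ_q⟩ iff f = f·χ_q`, i.e. iff `f` is supported inside `{x : q ∣ |x|}`).
* **Theorem 3.4.** "If `f ∈ ⟨χ_q⟩`, then `f = 0` or `f` has degree `≥ n/2`." ("nowhere did we assume
  that `q` was not composite, only that it is coprime with `p`, which is sufficient to find a `q`'th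
  root of unity in a large enough extension of `F_p`.") This improves Green's `⌊n/(2(q+1))⌋`
  (Comput. Complexity 9, 2000) and the `Ω(n)` bounds of Barrington–Beigel–Rudich and Tsai.

What is proved here (the printed proof re-expressed through the tree's Smolensky completeness lemma;
the same argument for EVERY residue class `|x| ≡ r (mod q)`, not only `r = 0`):

* `map_mulLeft_omMono_sup_eq_top_all` — Smolensky's completeness `Y·L + L = ⊤` for the character
  `Y = Π ω^{xᵢ}` and `L = lowDeg F n ⌊n/2⌋`, for EVERY `n` (the tree's
  `map_mulLeft_omMono_sup_eq_top` in `SmolenskyCharacter.lean` carries a needless `Odd n`; same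
  proof) [Smolensky 1987, proof of Thm. 2; = the mechanism of Beck–Li's proof: on `{1, ω}`-valued
  variables `yᵢ`, `Π_{i∈S} yᵢ · Π_i yᵢ' = Π_{i∉S} yᵢ'`];
* `eq_zero_of_lowDeg_of_support_subset_modClass` — over ANY field `F` with an element `ω ≠ 1`,
  `ω^q = 1`: if `f ∈ lowDeg F n t`, `2t < n`, and `f b ≠ 0 ⟹ |b| ≡ r (mod q)`, then `f = 0`
  (pair `f` against `Y·L + L = ⊤` with the signed cube pairing `Σ_u (−1)^{|u|} f(u) h(u)`, which
  kills degree `< n` — `sum_pmMono_univ_mul_eq_zero_of_mem_lowDeg` — and use `f·Y = ω^r f`);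
* `beckLi2013_thm34` — the printed setting: `p` prime, `p ∤ q`, `f : {0,1}ⁿ → 𝔽_p` of degree
  `≤ t` with `2t < n` supported inside `{b : |b| ≡ r (mod q)}` is zero (a `q`-th root of unity is
  taken in the algebraic closure of `𝔽_p`, as in `SmolenskyModq.lean`); `beckLi2013_thm34_dvd` —
  the literal `χ_q` form (`q ∣ |b|`).

Used by the QuantumAdvantage cell qa-qnc0 (route `RingFrame`, planner Sketch5 §18.2
`RelSmolensky`/`TwoClassBound`): the relative two-class bound for low-degree supports.
Deliberately NOT here: the tightness for `2q ∣ n`, the exact immunity `⌊(n+q−1)/q⌋` of `¬χ_q`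
(Thm. 5.x, symmetrization), §6–7.

## References

* C. Beck, Y. Li, *Represent MOD function by low degree polynomial with unbounded one-sided
  error*, arXiv:1304.0713 (2013), Def. 3.1, Obs. 3.2–3.3, Thm. 3.4 [BeckLi2013].
* R. Smolensky, *Algebraic methods in the theory of lower bounds for Boolean circuit complexity*,
  STOC 1987, 77–82, Thm. 2 (proof) [Smolensky1987].
* F. Green, *A complex-number Fourier technique for lower bounds on the Mod-m degree*,
  Comput. Complexity 9 (2000), 16–38.
-/

noncomputable section

namespace Literature.Computability.MetaComplexity

namespace Smolensky

open Finset Module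

variable {F : Type*} [Field F] {n : ℕ}

/-! ### Smolensky's completeness lemma for every `n` -/

/-- **Completeness of the character `Y = Π ω^{xᵢ}`, all `n`** (Smolensky 1987, proof of Thm. 2;
Beck–Li 2013, proof of Thm. 3.4): for `ω ≠ 0, 1` and `L = lowDeg F n ⌊n/2⌋`, `Y·L + L = ⊤` — every
monomial is a combination of `ω`-monomials `Π_{i∈U} yᵢ`, each either of degree `≤ n/2` or equal to
`Y` times the `ω⁻¹`-monomial `Π_{i∉U} yᵢ'` of degree `n − |U| ≤ n/2`. Same proof as the tree's
`map_mulLeft_omMono_sup_eq_top`, without its (unused) hypothesis `Odd n`.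
[cite: Smolensky1987, Thm. 2 (proof); BeckLi2013, Theorem 3.4 (proof)] -/
theorem map_mulLeft_omMono_sup_eq_top_all {ω : F} (hω0 : ω ≠ 0) (hω1 : ω ≠ 1) :
    (lowDeg F n (n / 2)).map (LinearMap.mulLeft F (omMono ω univ)) ⊔ lowDeg F n (n / 2) = ⊤ := by
  refine top_le_iff.1 ?_
  rw [← span_range_mono_eq_top, Submodule.span_le]
  rintro _ ⟨T, rfl⟩
  have hω1' : (ω - 1) ^ T.card ≠ 0 := pow_ne_zero _ (sub_ne_zero.2 hω1)
  have hT : mono F T = ((ω - 1) ^ T.card)⁻¹ • ((ω - 1) ^ T.card • mono F T) := by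
    rw [smul_smul, inv_mul_cancel₀ hω1', one_smul]
  rw [SetLike.mem_coe, hT, sub_one_pow_smul_mono_eq_sum]
  refine Submodule.smul_mem _ _ (Submodule.sum_mem _ fun U _ => Submodule.smul_mem _ _ ?_)
  by_cases hU : U.card ≤ n / 2
  · exact Submodule.mem_sup_right (omMono_mem_lowDeg ω hU)
  · refine Submodule.mem_sup_left ?_
    rw [← omMono_univ_mul_inv_compl hω0 U]
    refine Submodule.mem_map_of_mem (f := LinearMap.mulLeft F (omMono ω univ)) ?_
    refine omMono_mem_lowDeg ω⁻¹ ?_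
    rw [Finset.card_compl, Fintype.card_fin]
    omega

/-! ### No low-degree polynomial lives inside one residue class -/

/-- On the residue class `|b| ≡ r (mod q)` the character `Y = Π ω^{bᵢ}` is the constant `ω^{r mod q}`
(`ω^q = 1`). [cite: BeckLi2013, Observation 3.3] -/
theorem omMono_univ_apply_of_mod_eq {ω : F} {q : ℕ} (hωq : ω ^ q = 1) {b : Fin n → Bool} {r : ℕ}
    (h : (univ.filter fun i => b i = true).card % q = r % q) :
    omMono ω univ b = ω ^ (r % q) := by
  rw [omMono_apply, pow_eq_pow_mod_of_pow_eq_one hωq, h]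

/-- The indicator `δ_e` of a point, as a test function for the cube pairing. [folklore] -/
private theorem sum_pmMono_mul_mul_indicator (f : CubeFn F n) (e : Fin n → Bool) :
    ∑ u : Fin n → Bool, pmMono F univ u * (f u * (if u = e then (1 : F) else 0)) =
      pmMono F univ e * f e := by
  simp only [mul_ite, mul_one, mul_zero]
  rw [Finset.sum_ite_eq' univ e, if_pos (Finset.mem_univ e)]

/-- **Beck–Li 2013, Theorem 3.4 — general field form, every residue class.** Let `F` be a field
with an element `ω ≠ 1`, `ω^q = 1`. If `f : {0,1}ⁿ → F` has degree `≤ t` with `2t < n` and is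
supported inside one residue class `{b : |b| ≡ r (mod q)}`, then `f = 0`. Proof: `f·Y = ω^r·f`
(`Y = Π ω^{bᵢ}`), so the functional `h ↦ Σ_u (−1)^{|u|} f(u) h(u)` vanishes on `lowDeg ⌊n/2⌋`
(degree `t + ⌊n/2⌋ < n`, `sum_pmMono_univ_mul_eq_zero_of_mem_lowDeg`) and on `Y·lowDeg ⌊n/2⌋`,
hence on `⊤` (`map_mulLeft_omMono_sup_eq_top_all`), hence on every point indicator.
[cite: BeckLi2013, Theorem 3.4] -/
theorem eq_zero_of_lowDeg_of_support_subset_modClass {ω : F} {q : ℕ} (hq : 0 < q) (hωq : ω ^ q = 1)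
    (hω1 : ω ≠ 1) {t : ℕ} (ht : 2 * t < n) {f : CubeFn F n} (hf : f ∈ lowDeg F n t) (r : ℕ)
    (hsupp : ∀ b, f b ≠ 0 → (univ.filter fun i => b i = true).card % q = r % q) : f = 0 := by
  classical
  have hω0 : ω ≠ 0 := by
    rintro rfl
    rw [zero_pow hq.ne'] at hωq
    exact zero_ne_one hωq
  -- `f · Y = ω^r · f`
  have hfY : ∀ b, f b * omMono ω univ b = ω ^ (r % q) * f b := by
    intro b
    by_cases hb : f b = 0
    · rw [hb, zero_mul, mul_zero]
    · rw [omMono_univ_apply_of_mod_eq hωq (hsupp b hb), mul_comm]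
  -- the pairing functional vanishes on `lowDeg (n/2)` …
  have hlow : ∀ h ∈ lowDeg F n (n / 2), ∑ u : Fin n → Bool, pmMono F univ u * (f u * h u) = 0 := by
    intro h hh
    have hmul : f * h ∈ lowDeg F n (t + n / 2) := mul_mem_lowDeg_add hf hh
    exact sum_pmMono_univ_mul_eq_zero_of_mem_lowDeg (by omega) hmul
  -- … and on `Y · lowDeg (n/2)`
  have hhigh : ∀ h ∈ (lowDeg F n (n / 2)).map (LinearMap.mulLeft F (omMono ω univ)),
      ∑ u : Fin n → Bool, pmMono F univ u * (f u * h u) = 0 := by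
    intro h hh
    obtain ⟨c, hc, rfl⟩ := Submodule.mem_map.1 hh
    have hre : ∀ u : Fin n → Bool, pmMono F univ u * (f u * (LinearMap.mulLeft F (omMono ω univ) c) u) =
        ω ^ (r % q) * (pmMono F univ u * (f u * c u)) := by
      intro u
      rw [LinearMap.mulLeft_apply, Pi.mul_apply, ← mul_assoc (f u), hfY u]
      ring
    rw [Finset.sum_congr rfl fun u _ => hre u, ← Finset.mul_sum, hlow c hc, mul_zero]
  -- hence on everything
  have hall : ∀ h : CubeFn F n, ∑ u : Fin n → Bool, pmMono F univ u * (f u * h u) = 0 := by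
    intro h
    have hmem : h ∈ (lowDeg F n (n / 2)).map (LinearMap.mulLeft F (omMono ω univ)) ⊔ lowDeg F n (n / 2) := by
      rw [map_mulLeft_omMono_sup_eq_top_all hω0 hω1]; exact Submodule.mem_top
    obtain ⟨a, ha, b, hb, rfl⟩ := Submodule.mem_sup.1 hmem
    have hsplit : ∑ u : Fin n → Bool, pmMono F univ u * (f u * (a + b) u) =
        ∑ u : Fin n → Bool, pmMono F univ u * (f u * a u) +
          ∑ u : Fin n → Bool, pmMono F univ u * (f u * b u) := by
      rw [← Finset.sum_add_distrib]
      refine Finset.sum_congr rfl fun u _ => ?_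
      rw [Pi.add_apply]; ring
    rw [hsplit, hhigh a ha, hlow b hb, add_zero]
  -- test against point indicators
  funext e
  have h := hall fun u => if u = e then (1 : F) else 0
  rw [sum_pmMono_mul_mul_indicator] at h
  rcases mul_eq_zero.1 h with h1 | h1
  · have hsq := congrFun (pmMono_mul_self (F := F) (univ : Finset (Fin n))) e
    rw [Pi.mul_apply, h1, zero_mul, Pi.one_apply] at hsq
    exact (zero_ne_one hsq).elim
  · exact h1

/-! ### The printed setting: `𝔽_p`, `q` coprime to `p` -/

variable {p : ℕ} [Fact p.Prime]

/-- For `p ∤ q` (`q > 0`) the algebraic closure of `𝔽_p` contains an element `ω ≠ 1` with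
`ω^q = 1` (Beck–Li: "coprime with `p` … is sufficient to find a `q`'th root of unity in a large
enough extension of `F_p`"). [cite: BeckLi2013, §3 (remark after Theorem 3.4); Smolensky1987, Lemma 5] -/
theorem exists_root_of_unity_ne_one_of_not_dvd {q : ℕ} (hq : 1 < q) (hpq : ¬p ∣ q) :
    ∃ ω : AlgebraicClosure (ZMod p), ω ^ q = 1 ∧ ω ≠ 1 := by
  haveI : NeZero (q : ZMod p) := ⟨fun h => hpq ((ZMod.natCast_eq_zero_iff q p).1 h)⟩
  obtain ⟨ω, hω⟩ := HasEnoughRootsOfUnity.exists_primitiveRoot (AlgebraicClosure (ZMod p)) q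
  exact ⟨ω, hω.pow_eq_one, hω.ne_one hq⟩

/-- **Beck–Li 2013, Theorem 3.4 (immunity of `MOD_q` over `𝔽_p` is at least `n/2`), every
residue class.** Let `p` be prime, `q > 1` with `p ∤ q`, and let `f : {0,1}ⁿ → 𝔽_p` be a
polynomial function of degree `≤ t`, `2t < n`, with `f b ≠ 0 ⟹ |b| ≡ r (mod q)`. Then `f = 0`.
[cite: BeckLi2013, Theorem 3.4] -/
theorem beckLi2013_thm34 {q : ℕ} (hq : 1 < q) (hpq : ¬p ∣ q) {t : ℕ} (ht : 2 * t < n)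
    {f : CubeFn (ZMod p) n} (hf : f ∈ lowDeg (ZMod p) n t) (r : ℕ)
    (hsupp : ∀ b, f b ≠ 0 → (univ.filter fun i => b i = true).card % q = r % q) : f = 0 := by
  obtain ⟨ω, hωq, hω1⟩ := exists_root_of_unity_ne_one_of_not_dvd (p := p) hq hpq
  set K := AlgebraicClosure (ZMod p)
  set φ : ZMod p →+* K := algebraMap (ZMod p) K
  have hfK : (fun b => φ (f b)) ∈ lowDeg K n t := comp_mem_lowDeg φ hf
  have hsuppK : ∀ b, (fun b => φ (f b)) b ≠ 0 → (univ.filter fun i => b i = true).card % q = r % q := by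
    intro b hb
    refine hsupp b fun h0 => hb ?_
    simp only [h0, map_zero]
  have hK := eq_zero_of_lowDeg_of_support_subset_modClass (by omega) hωq hω1 ht hfK r hsuppK
  funext b
  have hb := congrFun hK b
  simp only [Pi.zero_apply] at hb
  rw [Pi.zero_apply]
  exact φ.injective (by rw [hb, map_zero])

/-- **Beck–Li 2013, Theorem 3.4, literal `χ_q` form:** a non-zero element of the ideal `⟨χ_q⟩` of
`𝔽_p[x]/(xᵢ² = xᵢ)` — a polynomial function supported inside `{b : q ∣ |b|}` — has degree
`≥ n/2`; i.e. with degree `≤ t`, `2t < n`, it is zero. [cite: BeckLi2013, Theorem 3.4] -/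
theorem beckLi2013_thm34_dvd {q : ℕ} (hq : 1 < q) (hpq : ¬p ∣ q) {t : ℕ} (ht : 2 * t < n)
    {f : CubeFn (ZMod p) n} (hf : f ∈ lowDeg (ZMod p) n t)
    (hsupp : ∀ b, f b ≠ 0 → q ∣ (univ.filter fun i => b i = true).card) : f = 0 :=
  beckLi2013_thm34 hq hpq ht hf 0 fun b hb => by
    rw [Nat.zero_mod]
    exact Nat.mod_eq_zero_of_dvd (hsupp b hb)

end Smolensky

end Literature.Computability.MetaComplexity
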